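import Literature.AlgebraicGeometry.FundamentalGroup.RiemannExistenceContinuousRationalNormal
import Literature.AlgebraicGeometry.FundamentalGroup.RiemannExistenceNormalSeparating
import Literature.AlgebraicGeometry.FundamentalGroup.RiemannExistenceZariskiLocal
import Literature.AlgebraicGeometry.HodgeTheory.QuasiProjectiveOfAffine
import Literature.AlgebraicGeometry.Resolution.AlterationsLemma32
import Literature.NumberTheory.Transcendental.AnalytificationProjProofs
import Literature.NumberTheory.Transcendental.AnalytificationSeparatedProofs
import HarnessLib

/-!
# Riemann's existence theorem ⇔ separating functions on finite coverings of normal affine varieties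

Topic `Literature/AlgebraicGeometry/FundamentalGroup`. The reductions of SGA 1 XII Thm. 5.1
(covering form, the named fact `riemannExistence_finiteCovering`) landed in this directory isolate
one transcendental residual: on every finite-fibred topological covering `q : T → S(ℂ)` of a NORMAL
AFFINE variety `S` and for every `P₀ ∈ S(ℂ)` there should be a continuous function `h : T → ℂ`,
integral (`riemannExistence_finiteCovering_of_integralSeparating`) or merely algebraic
(`riemannExistence_finiteCovering_of_algebraicSeparating`) over `Γ(S, 𝒪_S)` along `q`, which
separates the points of `q⁻¹(P₀)`. This file proves the converse
(`integralSeparating_of_riemannExistence`: if `T = S'(ℂ)` for a finite étale `S' → S`, a global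
function on the affine scheme `S'` with distinct values on the fibre — Chinese remainder theorem —
does it), so that both residual hypotheses are EQUIVALENT to the named fact
(`riemannExistence_finiteCovering_iff_integralSeparating`,
`riemannExistence_finiteCovering_iff_algebraicSeparating`): the algebraic and topological content
of SGA 1 XII 5.1 is entirely in the tree, and exactly its function-theoretic heart (existence of
holomorphic functions algebraic over `ℂ(S)` separating the sheets: Grauert–Remmert / GAGA) remains.

The section «The smooth case» closes the same circle for SMOOTH quasi-projective bases (the case
used by the fact's present dependents): `riemannExistence_smooth_of_algebraicSeparating`,
`integralSeparating_of_riemannExistence_smooth`, `riemannExistence_smooth_iff_algebraicSeparating`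
(⇔ the hypothesis of `riemannExistence_qbarDescent_of_finiteIndex_of_algebraicSeparating`),
`riemannExistence_smooth_of_riemannExistence_finiteCovering`; the common tool is the pointwise
`integralSeparating_of_isFinite`.

Everything here is proved; no definitions, no named facts.

## References

* [SGA1] A. Grothendieck, M. Raynaud, *SGA 1*, LNM 224 / arXiv:math/0206203, Exp. XII Thm. 5.1
  (p. 333) and its proof, part 2.

#harness_tags algebraic_geometry.sga1, algebraic_geometry.hodge_conjecture
-/

noncomputable section

open CategoryTheory AlgebraicGeometry Polynomial
open _root_.Topology

namespace Literature.AlgebraicGeometry.FundamentalGroup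

open Literature.AlgebraicGeometry.Motives Literature.AlgebraicGeometry.Motives.AlgPoints
open Literature.AlgebraicGeometry.HodgeTheory

/-- **Separating functions on an algebraic covering.** If the finite-fibred `q : T → S(ℂ)` (`S`
affine of finite type over `ℂ`) is `S'(ℂ) → S(ℂ)` for a FINITE `g : S' → S` (`T ≃ₜ S'(ℂ)` over
`S(ℂ)`), then for every `P₀ ∈ S(ℂ)` there is a continuous `h : T → ℂ`, INTEGRAL over `Γ(S, 𝒪_S)`
along `q` and injective on `q⁻¹(P₀)`: `S' = Spec B` is affine, take `b ∈ B` with prescribed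
distinct (integer) values at the finitely many points of `S'(ℂ)` over `P₀` (Chinese remainder
theorem for the corresponding maximal ideals of `B`), `h = b ∘ Φ⁻¹`, and a monic equation of `b`
over `Γ(S, 𝒪_S)` (`B` is finite over it). [cite: SGA1, Exp. XII Thm. 5.1 (p. 333), proof, part 2] -/
theorem integralSeparating_of_isFinite
    (S : Motives.SchemeOver ℂ) [IsAffine S.left] [LocallyOfFiniteType S.hom]
    {T : Type} [TopologicalSpace T] (q : T → Motives.ComplexPoints S)
    (hfin : ∀ t, (q ⁻¹' {t}).Finite) (P₀ : Motives.ComplexPoints S)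
    {S' : Motives.SchemeOver ℂ} (g : S' ⟶ S) [IsFinite g.left] (Φ : Motives.ComplexPoints S' ≃ₜ T)
    (hcomm : ∀ z, q (Φ z) = map g z) :
    ∃ (h : T → ℂ) (R : Polynomial Γ(S.left, ⊤)), Continuous h ∧ R.Monic ∧
      (∀ t, (R.map ((q t).evalRingHom ⊤ trivial)).eval (h t) = 0) ∧ Set.InjOn h (q ⁻¹' {P₀}) := by
  classical
  haveI : IsAffine S'.left := isAffine_of_isAffineHom g.left
  haveI : LocallyOfFiniteType S'.hom := by rw [← Over.w g]; infer_instance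
  -- the (finite) fibre of `S'(ℂ) → S(ℂ)` over `P₀`
  set F : Set (Motives.ComplexPoints S') := {z | map g z = P₀} with hFdef
  have hFeq : F = Φ ⁻¹' (q ⁻¹' {P₀}) := by
    ext z
    simp only [hFdef, Set.mem_setOf_eq, Set.mem_preimage, Set.mem_singleton_iff, hcomm]
  have hF : F.Finite := by
    rw [hFeq]
    exact (hfin P₀).preimage Φ.injective.injOn
  haveI : Finite F := hF.to_subtype
  -- the maximal ideals of `B = Γ(S', 𝒪)` at the points of `F`
  let 𝔪 : F → Ideal Γ(S'.left, ⊤) := fun z ↦ (S'.left.toSpecΓ.base z.1.pt).asIdeal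
  have h𝔪max : ∀ z, (𝔪 z).IsMaximal := fun z ↦ by
    rw [← PrimeSpectrum.isClosed_singleton_iff_isMaximal, ← Set.image_singleton]
    exact (S'.left.toSpecΓ.homeomorph.isClosed_image).mpr (ComplexPoints.isClosed_pt z.1)
  have h𝔪inj : Function.Injective 𝔪 := fun z z' h ↦ by
    apply Subtype.ext
    apply ComplexPoints.ext_of_pt_eq
    exact S'.left.toSpecΓ.homeomorph.injective (PrimeSpectrum.ext h)
  have hcop : Pairwise (Function.onFun IsCoprime 𝔪) := fun z z' hne ↦
    (Ideal.isCoprime_iff_sup_eq).mpr ((h𝔪max z).coprime_of_ne (h𝔪max z') (h𝔪inj.ne hne))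
  -- an element `b ∈ B` with distinct integer values on `F`
  obtain ⟨N, ⟨e⟩⟩ := Finite.exists_equiv_fin F
  obtain ⟨b, hb⟩ := Ideal.exists_forall_sub_mem_ideal hcop fun z ↦ ((e z : ℕ) : Γ(S'.left, ⊤))
  have hval : ∀ z : F, z.1.eval ⊤ trivial b = ((e z : ℕ) : ℂ) := by
    intro z
    have h1 : z.1.eval ⊤ trivial (b - ((e z : ℕ) : Γ(S'.left, ⊤))) = 0 := by
      by_contra hne
      have hmem : z.1.pt ∈ S'.left.basicOpen (b - ((e z : ℕ) : Γ(S'.left, ⊤))) :=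
        (pt_mem_basicOpen_iff z.1 (U := ⊤) trivial _).mpr hne
      rw [← Scheme.toSpecΓ_preimage_basicOpen] at hmem
      exact (PrimeSpectrum.mem_basicOpen _ _).mp hmem (hb z)
    rwa [← evalRingHom_apply, map_sub, map_natCast, sub_eq_zero, evalRingHom_apply] at h1
  -- a monic equation for `b` over `A = Γ(S, 𝒪)`
  obtain ⟨R, hRm, hRb⟩ := g.left.finite_appTop.to_isIntegral b
  -- evaluation at `q t = g(Φ⁻¹ t)` is evaluation at `Φ⁻¹ t` after `g^*`
  have hev : ∀ (z : Motives.ComplexPoints S') (a : Γ(S.left, ⊤)),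
      (map g z).eval ⊤ trivial a = z.eval ⊤ trivial (g.left.appTop a) := fun z a ↦
    eval_map g z ⊤ trivial a
  refine ⟨fun t ↦ (Φ.symm t).eval ⊤ trivial b, R, ?_, hRm, fun t ↦ ?_, ?_⟩
  · exact (AlgPoints.continuous_eval_top b).comp Φ.symm.continuous
  · have hqt : q t = map g (Φ.symm t) := by rw [← hcomm, Homeomorph.apply_symm_apply]
    have key : (q t).evalRingHom ⊤ trivial =
        ((Φ.symm t).evalRingHom ⊤ trivial).comp g.left.appTop.hom := by
      refine RingHom.ext fun a ↦ ?_
      rw [RingHom.comp_apply, evalRingHom_apply, evalRingHom_apply, ← hev, hqt]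
    beta_reduce
    rw [key, ← Polynomial.map_map, Polynomial.eval_map, ← evalRingHom_apply,
      Polynomial.eval₂_at_apply, Polynomial.eval_map, hRb, map_zero]
  · intro t ht t' ht' heq
    have hz : Φ.symm t ∈ F := by
      rw [hFeq, Set.mem_preimage, Homeomorph.apply_symm_apply]; exact ht
    have hz' : Φ.symm t' ∈ F := by
      rw [hFeq, Set.mem_preimage, Homeomorph.apply_symm_apply]; exact ht'
    have h1 : ((e ⟨_, hz⟩ : ℕ) : ℂ) = ((e ⟨_, hz'⟩ : ℕ) : ℂ) := by
      rw [← hval ⟨_, hz⟩, ← hval ⟨_, hz'⟩]; exact heq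
    have h2 : (⟨_, hz⟩ : F) = ⟨_, hz'⟩ := e.injective (Fin.ext (Nat.cast_injective h1))
    exact Φ.symm.injective (congrArg Subtype.val h2)

/-- **The residual hypothesis is necessary.** If `riemannExistence_finiteCovering` holds, then on
every finite-fibred covering `q : T → S(ℂ)` of an affine `ℂ`-scheme `S` of finite type, for every
`P₀ ∈ S(ℂ)`, there is a continuous `h : T → ℂ`, integral over `Γ(S, 𝒪_S)` along `q` and injective
on `q⁻¹(P₀)` (`integralSeparating_of_isFinite` for the finite étale `S' → S` with `S'(ℂ) ≅ T`
provided by the fact; `S` is quasi-projective by `IsQuasiProjectiveOver.of_isAffine`).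
[cite: SGA1, Exp. XII Thm. 5.1 (p. 333), proof, part 2] -/
theorem integralSeparating_of_riemannExistence (hRE : riemannExistence_finiteCovering)
    (S : Motives.SchemeOver ℂ) [IsAffine S.left] [LocallyOfFiniteType S.hom]
    {T : Type} [TopologicalSpace T] (q : T → Motives.ComplexPoints S) (hq : IsCoveringMap q)
    (hfin : ∀ t, (q ⁻¹' {t}).Finite) (P₀ : Motives.ComplexPoints S) :
    ∃ (h : T → ℂ) (R : Polynomial Γ(S.left, ⊤)), Continuous h ∧ R.Monic ∧
      (∀ t, (R.map ((q t).evalRingHom ⊤ trivial)).eval (h t) = 0) ∧ Set.InjOn h (q ⁻¹' {P₀}) := by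
  obtain ⟨S', g, Φ, hgfin, -, hcomm⟩ :=
    hRE S (IsQuasiProjectiveOver.of_isAffine S) T q hq hfin
  haveI := hgfin
  exact integralSeparating_of_isFinite S q hfin P₀ g Φ hcomm

/-- **`riemannExistence_finiteCovering` ⇔ integral separating functions on finite coverings of
normal affine varieties** (`riemannExistence_finiteCovering_of_integralSeparating` and
`integralSeparating_of_riemannExistence`): the transcendental residual isolated by the reduction
to normal affine schemes is EQUIVALENT to the named fact. [cite: SGA1, Exp. XII Thm. 5.1 (p. 333),
proof, part 2] -/
theorem riemannExistence_finiteCovering_iff_integralSeparating :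
    riemannExistence_finiteCovering ↔
      ∀ (S : Motives.SchemeOver ℂ), IsAffine S.left → LocallyOfFiniteType S.hom →
        IsDomain Γ(S.left, ⊤) → IsIntegrallyClosed Γ(S.left, ⊤) →
        ∀ (T : Type) [TopologicalSpace T] (q : T → Motives.ComplexPoints S) (_ : IsCoveringMap q)
          (_ : ∀ t, (q ⁻¹' {t}).Finite) (P₀ : Motives.ComplexPoints S),
          ∃ (h : T → ℂ) (R : Polynomial Γ(S.left, ⊤)), Continuous h ∧ R.Monic ∧
            (∀ t, (R.map ((q t).evalRingHom ⊤ trivial)).eval (h t) = 0) ∧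
            Set.InjOn h (q ⁻¹' {P₀}) :=
  ⟨fun hRE S hS hft _ _ T _ q hq hfin P₀ ↦ by
    haveI := hS; haveI := hft
    exact integralSeparating_of_riemannExistence hRE S q hq hfin P₀,
   riemannExistence_finiteCovering_of_integralSeparating⟩

/-- **`riemannExistence_finiteCovering` ⇔ algebraic separating functions on finite coverings of
normal affine varieties** (`riemannExistence_finiteCovering_of_algebraicSeparating` and
`integralSeparating_of_riemannExistence`; a monic equation is in particular a non-zero one).
[cite: SGA1, Exp. XII Thm. 5.1 (p. 333), proof, part 2] -/
theorem riemannExistence_finiteCovering_iff_algebraicSeparating :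
    riemannExistence_finiteCovering ↔
      ∀ (S : Motives.SchemeOver ℂ), IsAffine S.left → LocallyOfFiniteType S.hom →
        IsDomain Γ(S.left, ⊤) → IsIntegrallyClosed Γ(S.left, ⊤) →
        ∀ (T : Type) [TopologicalSpace T] (q : T → Motives.ComplexPoints S) (_ : IsCoveringMap q)
          (_ : ∀ t, (q ⁻¹' {t}).Finite) (P₀ : Motives.ComplexPoints S),
          ∃ (h : T → ℂ) (F : Polynomial Γ(S.left, ⊤)), Continuous h ∧ F ≠ 0 ∧
            (∀ t, (F.map ((q t).evalRingHom ⊤ trivial)).eval (h t) = 0) ∧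
            Set.InjOn h (q ⁻¹' {P₀}) :=
  ⟨fun hRE S hS hft hdom _ T _ q hq hfin P₀ ↦ by
    haveI := hS; haveI := hft; haveI := hdom
    obtain ⟨h, R, hh, hR, hroot, hinj⟩ := integralSeparating_of_riemannExistence hRE S q hq hfin P₀
    exact ⟨h, R, hh, hR.ne_zero, hroot, hinj⟩,
   riemannExistence_finiteCovering_of_algebraicSeparating⟩

/-! ### The smooth case

All present dependents of the named fact apply it to SMOOTH irreducible quasi-projective `S`. For
that case the same circle closes over smooth AFFINE bases, with the tree's regular-local-ring
version of Theorem B′ (`ContinuousRational.exists_charPoly_of_algebraic`) and the Zariski-localness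
of essential surjectivity (`ZariskiLocal.riemannExistence_of_affineOpens`). -/

section Smooth

open Literature.AlgebraicGeometry.Resolution

/-- **Riemann existence for smooth quasi-projective varieties from algebraic separating functions on
finite coverings of smooth affine varieties.** If for every smooth irreducible affine `ℂ`-scheme
`S`, every finite-fibred covering `q : T → S(ℂ)` and every `P₀ ∈ S(ℂ)` some continuous `h : T → ℂ`
algebraic over `Γ(S, 𝒪_S)` along `q` is injective on `q⁻¹(P₀)`, then every finite-fibred covering
of `S(ℂ)`, `S` smooth irreducible quasi-projective, is `S'(ℂ)` for a finite étale `S' → S`: the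
question is Zariski-local on `S` (`ZariskiLocal.riemannExistence_of_affineOpens`), and over a
smooth irreducible affine open it is Theorem B′ (`ContinuousRational.exists_charPoly_of_algebraic`,
the local rings being regular: `Scheme.IsRegular.of_smooth`) and Theorem A
(`CharPoly.exists_finite_etale_homeomorph_of_charPoly_of_isCoveringMap`) — the `ℂ`-part of
`riemannExistence_qbarDescent_of_finiteIndex_of_algebraicSeparating`.
[cite: SGA1, Exp. XII Thm. 5.1 (p. 333), proof, part 2] -/
theorem riemannExistence_smooth_of_algebraicSeparating
    (H : ∀ (S : Motives.SchemeOver ℂ), IsAffine S.left → AlgebraicGeometry.Smooth S.hom →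
      IrreducibleSpace S.left →
      ∀ (T : Type) [TopologicalSpace T] (q : T → Motives.ComplexPoints S) (_ : IsCoveringMap q)
        (_ : ∀ t, (q ⁻¹' {t}).Finite) (P₀ : Motives.ComplexPoints S),
        ∃ (h : T → ℂ) (F : Polynomial Γ(S.left, ⊤)), Continuous h ∧ F ≠ 0 ∧
          (∀ t, (F.map ((q t).evalRingHom ⊤ trivial)).eval (h t) = 0) ∧
          Set.InjOn h (q ⁻¹' {P₀}))
    (S : Motives.SchemeOver ℂ) (hS : IsQuasiProjectiveOver S) [AlgebraicGeometry.Smooth S.hom]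
    [IrreducibleSpace S.left] (T : Type) [TopologicalSpace T] (q : T → Motives.ComplexPoints S)
    (hq : IsCoveringMap q) (hfin : ∀ t, (q ⁻¹' {t}).Finite) :
    ∃ (S' : Motives.SchemeOver ℂ) (g : S' ⟶ S) (Φ : Motives.ComplexPoints S' ≃ₜ T),
      IsFinite g.left ∧ Etale g.left ∧ ∀ z, q (Φ z) = AlgPoints.map g z := by
  haveI : LocallyOfFiniteType S.hom := hS.locallyOfFiniteType
  haveI : IsSeparated S.hom := by
    obtain ⟨P, j, hP, hj⟩ := hS
    haveI := hj
    haveI : IsProper P.hom := hP.isProper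
    rw [← Over.w j]
    infer_instance
  -- `S` is integral: smooth over `ℂ` (regular, hence reduced) and irreducible
  have hSreg : Scheme.IsRegular S.left :=
    Scheme.IsRegular.of_smooth S.hom (Scheme.isRegular_Spec (CommRingCat.of ℂ))
  haveI : IsReduced S.left := hSreg.isReduced
  haveI : IsIntegral S.left := isIntegral_of_irreducibleSpace_of_isReduced _
  refine ZariskiLocal.riemannExistence_of_affineOpens (X := S) (fun U hU hne T' _ q' hq' hfin' ↦ ?_)
    q hq hfin
  -- the non-empty affine open `U ⊆ S` is affine, smooth over `ℂ`, irreducible, with regular local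
  -- rings
  haveI : Nonempty (U : Scheme) := hne.to_subtype
  haveI : IsIntegral (U : Scheme) := isIntegral_of_isOpenImmersion U.ι
  haveI : IsAffine (openSubschemeOver S U).left := hU
  haveI : AlgebraicGeometry.Smooth (openSubschemeOver S U).hom :=
    inferInstanceAs (AlgebraicGeometry.Smooth (U.ι ≫ S.hom))
  haveI : IrreducibleSpace (openSubschemeOver S U).left :=
    inferInstanceAs (IrreducibleSpace (U : Scheme))
  haveI : IsIntegral (openSubschemeOver S U).left := inferInstanceAs (IsIntegral (U : Scheme))
  haveI : LocallyOfFiniteType (openSubschemeOver S U).hom :=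
    inferInstanceAs (LocallyOfFiniteType (U.ι ≫ S.hom))
  haveI : IsSeparated (openSubschemeOver S U).hom := inferInstance
  have hUreg : Scheme.IsRegular (openSubschemeOver S U).left :=
    Scheme.IsRegular.of_smooth (openSubschemeOver S U).hom (Scheme.isRegular_Spec (CommRingCat.of ℂ))
  refine CharPoly.exists_finite_etale_homeomorph_of_charPoly_of_isCoveringMap q' hq' hfin' fun P₀ ↦ ?_
  obtain ⟨h, F, hh, hF, hroot, hinj⟩ := H _ ‹_› ‹_› ‹_› T' q' hq' hfin' P₀
  obtain ⟨Q, hQ, hroots⟩ := ContinuousRational.exists_charPoly_of_algebraic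
    (X := openSubschemeOver S U) hUreg (U := ⊤) (isAffineOpen_top _) hq' hfin' h hh.continuousOn F
    hF (fun t _ ↦ hroot t)
  exact ⟨⊤, isAffineOpen_top _, trivial, h, Q, hh.continuousOn, hQ, hroots, hinj⟩

/-- Conversely, Riemann existence for smooth irreducible quasi-projective `S` gives INTEGRAL (in
particular algebraic) separating functions on finite coverings of smooth irreducible affine `S`
(`integralSeparating_of_isFinite`). [cite: SGA1, Exp. XII Thm. 5.1 (p. 333), proof, part 2] -/
theorem integralSeparating_of_riemannExistence_smooth
    (hRE : ∀ (S : Motives.SchemeOver ℂ), IsQuasiProjectiveOver S → AlgebraicGeometry.Smooth S.hom →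
      IrreducibleSpace S.left →
      ∀ (T : Type) [TopologicalSpace T] (q : T → Motives.ComplexPoints S),
        IsCoveringMap q → (∀ t, (q ⁻¹' {t}).Finite) →
        ∃ (S' : Motives.SchemeOver ℂ) (g : S' ⟶ S) (Φ : Motives.ComplexPoints S' ≃ₜ T),
          IsFinite g.left ∧ Etale g.left ∧ ∀ z, q (Φ z) = AlgPoints.map g z)
    (S : Motives.SchemeOver ℂ) [IsAffine S.left] [AlgebraicGeometry.Smooth S.hom]
    [IrreducibleSpace S.left] {T : Type} [TopologicalSpace T] (q : T → Motives.ComplexPoints S)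
    (hq : IsCoveringMap q) (hfin : ∀ t, (q ⁻¹' {t}).Finite) (P₀ : Motives.ComplexPoints S) :
    ∃ (h : T → ℂ) (R : Polynomial Γ(S.left, ⊤)), Continuous h ∧ R.Monic ∧
      (∀ t, (R.map ((q t).evalRingHom ⊤ trivial)).eval (h t) = 0) ∧ Set.InjOn h (q ⁻¹' {P₀}) := by
  haveI : LocallyOfFiniteType S.hom := inferInstance
  obtain ⟨S', g, Φ, hgfin, -, hcomm⟩ :=
    hRE S (IsQuasiProjectiveOver.of_isAffine S) ‹_› ‹_› T q hq hfin
  haveI := hgfin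
  exact integralSeparating_of_isFinite S q hfin P₀ g Φ hcomm

/-- **Riemann existence for smooth quasi-projective varieties ⇔ algebraic separating functions on
finite coverings of smooth affine varieties** (`riemannExistence_smooth_of_algebraicSeparating`,
`integralSeparating_of_riemannExistence_smooth`). The right-hand side is the hypothesis of
`riemannExistence_qbarDescent_of_finiteIndex_of_algebraicSeparating`; the left-hand side is the case
of `riemannExistence_finiteCovering` used by its present dependents
(`riemannExistence_smooth_of_riemannExistence_finiteCovering`).
[cite: SGA1, Exp. XII Thm. 5.1 (p. 333), proof, part 2] -/
theorem riemannExistence_smooth_iff_algebraicSeparating :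
    (∀ (S : Motives.SchemeOver ℂ), IsQuasiProjectiveOver S → AlgebraicGeometry.Smooth S.hom →
      IrreducibleSpace S.left →
      ∀ (T : Type) [TopologicalSpace T] (q : T → Motives.ComplexPoints S),
        IsCoveringMap q → (∀ t, (q ⁻¹' {t}).Finite) →
        ∃ (S' : Motives.SchemeOver ℂ) (g : S' ⟶ S) (Φ : Motives.ComplexPoints S' ≃ₜ T),
          IsFinite g.left ∧ Etale g.left ∧ ∀ z, q (Φ z) = AlgPoints.map g z) ↔
    (∀ (S : Motives.SchemeOver ℂ), IsAffine S.left → AlgebraicGeometry.Smooth S.hom →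
      IrreducibleSpace S.left →
      ∀ (T : Type) [TopologicalSpace T] (q : T → Motives.ComplexPoints S) (_ : IsCoveringMap q)
        (_ : ∀ t, (q ⁻¹' {t}).Finite) (P₀ : Motives.ComplexPoints S),
        ∃ (h : T → ℂ) (F : Polynomial Γ(S.left, ⊤)), Continuous h ∧ F ≠ 0 ∧
          (∀ t, (F.map ((q t).evalRingHom ⊤ trivial)).eval (h t) = 0) ∧
          Set.InjOn h (q ⁻¹' {P₀})) := by
  refine ⟨fun hRE S hS hsm hirr T _ q hq hfin P₀ ↦ ?_,
    fun H S hS hsm hirr T _ q hq hfin ↦ ?_⟩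
  · haveI := hS; haveI := hsm; haveI := hirr
    -- `Γ(S, 𝒪_S)` is a domain (`S` integral), so a monic polynomial is non-zero
    have hSreg : Scheme.IsRegular S.left :=
      Scheme.IsRegular.of_smooth S.hom (Scheme.isRegular_Spec (CommRingCat.of ℂ))
    haveI : IsReduced S.left := hSreg.isReduced
    haveI : IsIntegral S.left := isIntegral_of_irreducibleSpace_of_isReduced _
    obtain ⟨h, R, hh, hR, hroot, hinj⟩ :=
      integralSeparating_of_riemannExistence_smooth hRE S q hq hfin P₀
    exact ⟨h, R, hh, hR.ne_zero, hroot, hinj⟩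
  · haveI := hsm; haveI := hirr
    exact riemannExistence_smooth_of_algebraicSeparating H S hS T q hq hfin

/-- The smooth case of the named fact, as used by its present dependents
(`HodgeTheory.exists_finiteEtale_of_finiteIndex_of_riemannExistence` and the `ℚ̄`-descent files).
[cite: SGA1, Exp. XII Thm. 5.1 (p. 333)] -/
theorem riemannExistence_smooth_of_riemannExistence_finiteCovering
    (hRE : riemannExistence_finiteCovering) (S : Motives.SchemeOver ℂ) (hS : IsQuasiProjectiveOver S)
    [AlgebraicGeometry.Smooth S.hom] [IrreducibleSpace S.left] (T : Type) [TopologicalSpace T]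
    (q : T → Motives.ComplexPoints S) (hq : IsCoveringMap q) (hfin : ∀ t, (q ⁻¹' {t}).Finite) :
    ∃ (S' : Motives.SchemeOver ℂ) (g : S' ⟶ S) (Φ : Motives.ComplexPoints S' ≃ₜ T),
      IsFinite g.left ∧ Etale g.left ∧ ∀ z, q (Φ z) = AlgPoints.map g z :=
  hRE S hS T q hq hfin

end Smooth

end Literature.AlgebraicGeometry.FundamentalGroup

end
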